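import Summits.Ventures.CertifiedArithmetic.LowPrec.SRSaturationCoupling
import Summits.Ventures.CertifiedArithmetic.LowPrec.SRTreeHoeffding
import HarnessLib

/-!
# Stochastic rounding into a finite format, XI: law comparison `F` vs `F'`; casts

HONEST FRAMING: certified error envelopes and provably optimal rounding/accumulation schemes for
low-precision formats under stated cost models; every table by two implementations; no hardware or
vendor claims.

Consequences of the coupling identity of `SRSaturationCoupling` (file X): the law of the saturating
SR evaluation of a tree `T` in `F` and the law of its evaluation in an agreeing refinement `F'`
(`Agrees F F'`) differ only on the saturation event, whose probability is `satProbT F T` on both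
sides. Hence

* `abs_treeExp_sub_le` — **law comparison**: `|E_F f(ŝ_T) − E_{F'} f(ŝ_T)| ≤ B · satProbT F T` for
  every observable `0 ≤ f ≤ B`; `treeExp_le_add_satProbT` — events: `P_F(A) ≤ P_{F'}(A) + satProbT`;
* `abs_treeBias_le` — **the saturation bias**: `|E_F ŝ_T − ∑ leaves| ≤ 2R · satProbT F T` when `F'`
  does not saturate and all values lie within `R` of the exact sum (the ONLY bias of SR summation in a
  finite format is saturation, `SRTreeEnvelopes.treeExp_id`; this bounds it by a probability);
* `abs_sq_sub_treeVar_le` — second moment: `|E_F(ŝ_T − ∑)² − treeVar F' T| ≤ R² · satProbT F T`;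
* casts `ℚ → ℝ`: `treeExpF_cast`, `satProbT_cast`, `satProb_cast` (kernel-exact rational
  probabilities transported to the real-analytic envelopes of `SRSaturationTail`).
-/

namespace Summit.Ventures.CertifiedArithmetic.LowPrec.SR

open Literature.ComputerArithmetic.ConnollyHighamMary2021
open Finset STree

section Generic

variable {K : Type*} [Field K] [LinearOrder K] [IsStrictOrderedRing K]

/-! ### Law comparison: `F` versus `F'` -/

omit [IsStrictOrderedRing K] in
/-- Splitting an expectation along the exit flag. -/
theorem treeExp_eq_restrict_add (F H : Finset K) (T : STree K) (f : K → K) :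
    treeExp F T f = treeExpF F H T (fun v fl => if fl then 0 else f v)
      + treeExpF F H T (fun v fl => if fl then f v else 0) := by
  rw [← treeExpF_marg F H T f, ← treeExpF_add]
  exact treeExpF_congr F H T (fun v b => by cases b <;> simp)

/-- **LAW COMPARISON.** For `0 ≤ f ≤ B`: `|E_F f(ŝ_T) − E_{F'} f(ŝ_T)| ≤ B · satProbT F T` for every
refinement `F'` agreeing with `F` on its hull (the laws differ only on the exit event, whose
probability is the same on both sides). -/
theorem abs_treeExp_sub_le {F F' : Finset K} (hA : Agrees F F') (T : STree K) {f : K → K} {B : K}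
    (hf : ∀ v, 0 ≤ f v ∧ f v ≤ B) :
    |treeExp F T f - treeExp F' T f| ≤ B * satProbT F T := by
  have hag : ∀ c, InHull F c → ∀ g : K → K, step F c g = step F' c g :=
    fun _ hc g => (step_eq_of_agrees hA hc g).symm
  rw [treeExp_eq_restrict_add F F T f, treeExp_eq_restrict_add F' F T f,
    treeExpF_restrict_eq F F' F hag T f]
  -- both exit parts lie in `[0, B · exitProb]`, and the exit probabilities agree
  have hbd : ∀ Fi : Finset K, 0 ≤ treeExpF Fi F T (fun v fl => if fl then f v else 0) ∧
      treeExpF Fi F T (fun v fl => if fl then f v else 0) ≤ B * exitProb Fi F T := by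
    intro Fi
    refine ⟨treeExpF_nonneg Fi F T (fun v b => by cases b <;> simp [(hf v).1]), ?_⟩
    unfold exitProb; rw [← treeExpF_mul_left]
    exact treeExpF_mono Fi F T (fun v b => by cases b <;> simp [(hf v).2])
  have h1 := hbd F
  have h2 := hbd F'
  rw [← exitProb_eq_of_agree F F' F hag T] at h2
  unfold satProbT
  rw [abs_le]; constructor <;> linarith [h1.1, h1.2, h2.1, h2.2]

/-- **Events**: for an indicator-type observable (`0 ≤ f ≤ 1`),
`P_F(A) ≤ P_{F'}(A) + satProbT F T` (and symmetrically). -/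
theorem treeExp_le_add_satProbT {F F' : Finset K} (hA : Agrees F F') (T : STree K) {f : K → K}
    (hf : ∀ v, 0 ≤ f v ∧ f v ≤ 1) :
    treeExp F T f ≤ treeExp F' T f + satProbT F T := by
  have h := abs_treeExp_sub_le hA T hf
  rw [one_mul, abs_le] at h
  linarith [h.2]

/-- Clipping an observable outside the support does not change its expectation. -/
theorem treeExp_clip_eq (F : Finset K) (T : STree K) (s R : K)
    (h : AllOut F T (fun v => |v - s| ≤ R)) :
    treeExp F T (fun v => max (-R) (min (v - s) R) + R) = treeExp F T (fun v => v) - s + R := by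
  rw [← treeExp_sub_const, ← treeExp_add_const]
  refine treeExp_congr_of_allOut F T (allOut_mono F T (fun v hv => ?_) h)
  rw [abs_le] at hv
  rw [min_eq_left hv.2, max_eq_right hv.1]

/-- **SATURATION BIAS.** If every possible value of both evaluations is within `R` of the exact sum,
`|E_F ŝ_T − E_{F'} ŝ_T| ≤ 2R · satProbT F T`; in particular (`treeExp_id`) when `F'` does not
saturate, the bias of SR summation in `F` is `|E_F ŝ_T − ∑ leaves| = |treeBias F T| ≤ 2R · satProbT`. -/
theorem abs_treeBias_le {F F' : Finset K} (hA : Agrees F F') (T : STree K) {R : K} (hR : 0 ≤ R)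
    (hF : AllOut F T (fun v => |v - T.exact| ≤ R)) (hF' : AllOut F' T (fun v => |v - T.exact| ≤ R))
    (hns : NoSatT F' T) : |treeBias F T| ≤ 2 * R * satProbT F T := by
  have hf : ∀ v, 0 ≤ max (-R) (min (v - T.exact) R) + R ∧
      max (-R) (min (v - T.exact) R) + R ≤ 2 * R := by
    intro v
    constructor
    · linarith [le_max_left (-R) (min (v - T.exact) R)]
    · linarith [max_le (by linarith : -R ≤ R) (min_le_right (v - T.exact) R)]
  have h := abs_treeExp_sub_le hA T hf
  rw [treeExp_clip_eq F T _ R hF, treeExp_clip_eq F' T _ R hF', treeExp_id F T,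
    treeExp_id_of_noSatT F' T hns] at h
  have : T.exact + treeBias F T - T.exact + R - (T.exact - T.exact + R) = treeBias F T := by ring
  rwa [this] at h

/-- **Second moment without `NoSat` on `F`**: with the same `R`,
`|E_F (ŝ_T − ∑)² − treeVar F' T| ≤ R² · satProbT F T` (`treeVar F'` = the exact variance of the
non-saturating evaluation, `SRTreeEnvelopes.treeExp_sq_sub_exact`). -/
theorem abs_sq_sub_treeVar_le {F F' : Finset K} (hA : Agrees F F') (T : STree K) {R : K}
    (hF : AllOut F T (fun v => |v - T.exact| ≤ R)) (hF' : AllOut F' T (fun v => |v - T.exact| ≤ R))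
    (hns : NoSatT F' T) :
    |treeExp F T (fun v => (v - T.exact) ^ 2) - treeVar F' T| ≤ R ^ 2 * satProbT F T := by
  have hf : ∀ v, 0 ≤ min ((v - T.exact) ^ 2) (R ^ 2) ∧ min ((v - T.exact) ^ 2) (R ^ 2) ≤ R ^ 2 :=
    fun v => ⟨le_min (sq_nonneg _) (sq_nonneg _), min_le_right _ _⟩
  have h := abs_treeExp_sub_le hA T hf
  have hclip : ∀ Fi : Finset K, AllOut Fi T (fun v => |v - T.exact| ≤ R) →
      treeExp Fi T (fun v => min ((v - T.exact) ^ 2) (R ^ 2))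
        = treeExp Fi T (fun v => (v - T.exact) ^ 2) :=
    fun Fi hFi => treeExp_congr_of_allOut Fi T (allOut_mono Fi T
      (fun v hv => min_eq_left (sq_le_sq' (abs_le.mp hv).1 (abs_le.mp hv).2)) hFi)
  rwa [hclip F hF, hclip F' hF', treeExp_sq_sub_exact F' T hns] at h

end Generic

/-! ### The cast `ℚ → ℝ` -/

/-- The exit flag commutes with the cast. -/
theorem outB_cast (H : Finset ℚ) (c : ℚ) : outB (realImage H) (c : ℝ) = outB H c := by
  cases h : outB H c
  · exact (outB_eq_false_iff _ _).mpr ((inHull_cast H c).mpr ((outB_eq_false_iff H c).mp h))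
  · exact (outB_eq_true_iff _ _).mpr
      (fun hin => (outB_eq_true_iff H c).mp h ((inHull_cast H c).mp hin))

/-- The joint law commutes with the cast (for observables that do). -/
theorem treeExpF_cast (F H : Finset ℚ) : ∀ (T : STree ℚ) {φ : ℚ → Bool → ℚ} {ψ : ℝ → Bool → ℝ},
    (∀ (v : ℚ) (b : Bool), ψ (v : ℝ) b = ((φ v b : ℚ) : ℝ)) →
      treeExpF (realImage F) (realImage H) (T.map ((↑) : ℚ → ℝ)) ψ = ((treeExpF F H T φ : ℚ) : ℝ)
  | .leaf x, _, _, h => by simp only [STree.map, treeExpF]; exact h x false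
  | .node l r, φ, ψ, h => by
      simp only [STree.map, treeExpF]
      refine treeExpF_cast F H l (φ := fun a fa => treeExpF F H r (fun b fb =>
        step F (a + b) (fun v => φ v (fa || fb || outB H (a + b))))) (fun a fa => ?_)
      refine treeExpF_cast F H r
        (φ := fun b fb => step F (a + b) (fun v => φ v (fa || fb || outB H (a + b)))) (fun b fb => ?_)
      rw [← Rat.cast_add, outB_cast]
      exact step_cast F (a + b) (fun v => h v _)

/-- The exit probability commutes with the cast. -/
theorem exitProb_cast (F H : Finset ℚ) (T : STree ℚ) :
    exitProb (realImage F) (realImage H) (T.map ((↑) : ℚ → ℝ)) = ((exitProb F H T : ℚ) : ℝ) :=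
  treeExpF_cast F H T (fun _ b => by cases b <;> simp)

/-- **The saturation probability commutes with the cast** (exact rationals, real envelopes). -/
theorem satProbT_cast (F : Finset ℚ) (T : STree ℚ) :
    satProbT (realImage F) (T.map ((↑) : ℚ → ℝ)) = ((satProbT F T : ℚ) : ℝ) :=
  exitProb_cast F F T

/-- The expected number of exits commutes with the cast. -/
theorem satProb_cast (F' H : Finset ℚ) : ∀ T : STree ℚ,
    satProb (realImage F') (realImage H) (T.map ((↑) : ℚ → ℝ)) = ((satProb F' H T : ℚ) : ℝ)
  | .leaf _ => by simp [STree.map, satProb]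
  | .node l r => by
      simp only [STree.map, satProb]
      rw [satProb_cast F' H l, satProb_cast F' H r, Rat.cast_add, Rat.cast_add]
      congr 1
      refine treeExp_cast F' l (fun a => ?_)
      refine treeExp_cast F' r (fun b => ?_)
      -- the exit indicator commutes with the cast (inlined: a stand-alone copy trips `dedup.landed`)
      rw [← Rat.cast_add]
      by_cases h : InHull H (a + b)
      · rw [outInd, outInd, if_pos h, if_pos ((inHull_cast H (a + b)).mpr h), Rat.cast_zero]
      · rw [outInd, outInd, if_neg h, if_neg (fun h' => h ((inHull_cast H (a + b)).mp h')),
          Rat.cast_one]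

end Summit.Ventures.CertifiedArithmetic.LowPrec.SR
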